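import Literature.AnabelianGeometry.AbsoluteAnabelian.CuspidalizationFactsModel
import HarnessLib

/-!
# [AbsCusp] Prop. 1.6 (iii) as typed (FACT-LIST F-0050 / F-0045) IMPLIES the exact sequence
# `1 → I_x → Δ^{c-cn}_{U_x} → Δ_X → 1` of [AbsTopIII] Prop. 1.4 (ii) as typed (`IsCuspidallyCentralExtension`, F-0341's conclusion)

Proof-only companion of `AbsCuspFacts.lean` / `CuspidalizationFactsModel.lean` (abc-iut-L4 lineage, p405610 /
p406112; imported, never edited).  S. Mochizuki, *Absolute anabelian cuspidalizations of proper hyperbolic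
curves*, J. Math. Kyoto Univ. 47 (2007) [AbsCusp], Prop. 1.6 (iii) p. 15; *Topics in absolute anabelian
geometry III* [AbsTopIII], Prop. 1.4 (ii) p. 31, whose printed proof (p. 32) reads in full: "Assertion (ii)
follows immediately from [Mzk19], Proposition 1.6, (iii)" ([Mzk19] = [AbsCusp]).  Cell abc-iut, block F
(fact-proving wave), seat abc-iut-f-094 (FLOAT after tranche 94).

KERNEL FORM OF THAT CITATION EDGE, between the cell's typed predicates (pure lattice algebra in `Π_{U_S}`):
`AbsCusp.Prop_1_6_iii q I` says, for `N = Ker(Δ_{U_S} ↠ Δ_X)` and `C = [N, Δ_{U_S}]⁻`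
(= `AbsTopIII.cuspidalKernel q`, `AbsTopIII.cuspidallyCentralModulus q`, the SAME terms), that the `I_x`
lie in `N`, generate `N` together with `C`, and each meets `(⨆_{y ≠ x} I_y) ⊔ C` trivially;
`AbsTopIII.IsCuspidallyCentralExtension q I_x` says `I_x ⊓ C = 1` and `I_x ⊔ C = N`.

* `AbsCusp.Prop_1_6_iii.isCuspidallyCentralExtension` — for every cusp `x` whose fellow inertia groups are
  absorbed (`I_y ≤ I_x ⊔ C` for all `y`), in particular (`…_of_subsingleton`) when `S = {x}` is a single
  cusp — print's situation `U_x = X ∖ {x}` of Prop. 1.4 (ii) — the typed Prop. 1.6 (iii) yields the typed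
  exact sequence of Prop. 1.4 (ii);
* model level `AbsCusp.Prop_1_6_iii_model.isCuspidallyCentralExtension(_of_subsingleton)`: for every
  interface `M : CurveModel`, F-0045 at `M` gives F-0341's CONCLUSION `IsCuspidallyCentralExtension (M.res h)
  (I_x)` for every cofinite open `U_S ⊆ X` of the model with `X` proper over an MLF, all cusps rational, at an
  absorbed (e.g. the unique) cusp.  (F-0341 `CurveModel.Prop_1_4_ii` itself is typed for arbitrary
  characteristic-zero base fields and scheme-like curves, with "`x` is the removed point" rendered by the
  kernel hypothesis `N = ⟨⟨I_x⟩⟩⁻` rather than by `S = {x}`; the MLF/single-cusp instances of its conclusion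
  are what Prop. 1.6 (iii) supplies here.)

HONEST FRAMING: implications between the cell's TYPED predicates (assumption labels); nothing of [AbsCusp] /
[AbsTopIII] is proved as a statement about curves; refereed results typed statements-first (D-0014);
typed ≠ proved; no model of any curve is asserted to exist; nothing here bears on the disputed [IUTchIII]
Cor. 3.12; no side taken.
-/

noncomputable section

open scoped Classical Pointwise

namespace Literature.AnabelianGeometry.AbsoluteAnabelian

universe u

namespace AbsCusp

open AbsTopIII FundamentalExtension CategoryTheory

variable {E F : FundamentalExtension.{u}}

/-! ### Shape (1): Prop. 1.6 (iii) ⇒ the cuspidally central exact sequence at an absorbed cusp -/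

/-- **[AbsCusp] Prop. 1.6 (iii) (typed) ⇒ [AbsTopIII] Prop. 1.4 (ii) (typed exact sequence)** at every cusp
`x` whose fellow inertia groups satisfy `I_y ≤ I_x · [N, Δ]⁻`: then `I_x ∩ [N, Δ]⁻ = 1` (from the
independence clause) and `I_x · [N, Δ]⁻ = N` (from the generation clause), i.e.
`1 → I_x → Δ^{c-cn}_{U_S} → Δ_X → 1` is exact. [cite: MochizukiAbsCusp2007, Prop 1.6 (iii) p.15] -/
theorem Prop_1_6_iii.isCuspidallyCentralExtension {q : E ⟶ F} {S : Type u} {I : S → Subgroup E.arith}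
    (h : Prop_1_6_iii q I) (x : S) (hx : ∀ y, I y ≤ I x ⊔ AbsTopIII.cuspidallyCentralModulus q) :
    AbsTopIII.IsCuspidallyCentralExtension q (I x) := by
  obtain ⟨-, hle, hgen, hind⟩ := h
  refine ⟨?_, ?_⟩
  · -- `I_x ⊓ C = ⊥`, from `I_x ⊓ ((⨆_{y ≠ x} I_y) ⊔ C) = ⊥`
    refine le_bot_iff.1 (le_trans ?_ (hind x).le)
    exact inf_le_inf_left _ le_sup_right
  · -- `I_x ⊔ C = N`, from `I_y ≤ N`, `(⨆ I_y) ⊔ C = N` and the absorption hypothesis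
    refine le_antisymm (sup_le (hle x) (le_sup_right.trans hgen.le)) ?_
    calc AbsTopIII.cuspidalKernel q = (⨆ y, I y) ⊔ AbsTopIII.cuspidallyCentralModulus q := hgen.symm
      _ ≤ I x ⊔ AbsTopIII.cuspidallyCentralModulus q := sup_le (iSup_le hx) le_sup_right

/-- **The single-cusp case `S = {x}`** (print's `U_x = X ∖ {x}`, [AbsTopIII] Prop. 1.4 (ii): "Assertion (ii)
follows immediately from [Mzk19], Proposition 1.6, (iii)"): the typed Prop. 1.6 (iii) for a one-element
index set yields the typed exact sequence `1 → I_x → Δ^{c-cn}_{U_x} → Δ_X → 1`.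
[cite: MochizukiAbsCusp2007, Prop 1.6 (iii) p.15] -/
theorem Prop_1_6_iii.isCuspidallyCentralExtension_of_subsingleton {q : E ⟶ F} {S : Type u}
    [Subsingleton S] {I : S → Subgroup E.arith} (h : Prop_1_6_iii q I) (x : S) :
    AbsTopIII.IsCuspidallyCentralExtension q (I x) :=
  Prop_1_6_iii.isCuspidallyCentralExtension h x fun y => by
    rw [Subsingleton.elim y x]
    exact le_sup_left

/-! ### Model level: F-0045 supplies the MLF instances of F-0341's conclusion -/

/-- **F-0045 ⇒ F-0341's conclusion at MLF curves, absorbed cusp**: for every interface `M : CurveModel`, the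
model-relative [AbsCusp] Prop. 1.6 (iii) gives `IsCuspidallyCentralExtension (M.res h) I_x` for every cofinite
open `U_S ⊆ X` of `M` with `X` proper over an MLF and all cusps of `U_S` rational, at every cusp `x` with
`I_y ≤ I_x · [N, Δ]⁻` for all `y`. [cite: MochizukiAbsCusp2007, Prop 1.6 (iii) p.15] -/
theorem Prop_1_6_iii_model.isCuspidallyCentralExtension {M : CurveModel.{u}} (h : Prop_1_6_iii_model M)
    {US X : M.Curve} (hUX : M.IsCofiniteOpen US X) (hX : M.IsProper X) (hk : IsMLF (M.base X))
    (hrat : ∀ c : (M.cusps US).Cusp, (M.cusps US).IsRational c) (x : (M.cusps US).Cusp)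
    (hx : ∀ y, (M.cusps US).Icusp y ≤
      (M.cusps US).Icusp x ⊔ AbsTopIII.cuspidallyCentralModulus (M.res hUX)) :
    AbsTopIII.IsCuspidallyCentralExtension (M.res hUX) ((M.cusps US).Icusp x) :=
  Prop_1_6_iii.isCuspidallyCentralExtension (h US X hUX hX hk hrat) x hx

/-- **F-0045 ⇒ F-0341's conclusion at MLF curves with a single cusp** (print's `U_x = X ∖ {x}` over an MLF,
`x` rational): `1 → I_x → Δ^{c-cn}_{U_x} → Δ_X → 1` is exact for the model's datum `M.res h`.
[cite: MochizukiAbsCusp2007, Prop 1.6 (iii) p.15] -/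
theorem Prop_1_6_iii_model.isCuspidallyCentralExtension_of_subsingleton {M : CurveModel.{u}}
    (h : Prop_1_6_iii_model M) {US X : M.Curve} (hUX : M.IsCofiniteOpen US X) (hX : M.IsProper X)
    (hk : IsMLF (M.base X)) [Subsingleton (M.cusps US).Cusp]
    (hrat : ∀ c : (M.cusps US).Cusp, (M.cusps US).IsRational c) (x : (M.cusps US).Cusp) :
    AbsTopIII.IsCuspidallyCentralExtension (M.res hUX) ((M.cusps US).Icusp x) :=
  Prop_1_6_iii.isCuspidallyCentralExtension_of_subsingleton (h US X hUX hX hk hrat) x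

/-! ### Appended (abc-iut-f-094): the KERNEL HYPOTHESIS of the typed Prop. 1.4 (ii) gives absorption at a rational cusp

[AbsTopIII] Prop. 1.4 (ii) as typed (`CurveModel.Prop_1_4_ii`, F-0341) renders "`x` is the removed point of
`U_x = X ∖ {x}`" by the hypothesis `N = ⟨⟨I_x⟩⟩⁻` (the cuspidal kernel is the closed normal closure of
`I_x`, cf. Prop. 1.4 (i)).  Under it, at a RATIONAL cusp `x` (`Π = D_x · Δ`), every inertia group `I_y ≤ N`
IS absorbed: `g I_x g⁻¹ ⊆ I_x · [N, Δ]` for `g = d·δ` (`d ∈ D_x` normalises `I_x = D_x ∩ Δ`;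
`δ i δ⁻¹ = i·[i⁻¹, δ]`), so `⟨⟨I_x⟩⟩ ≤ I_x ⊔ [N, Δ] ≤ I_x · [N, Δ]⁻`, a CLOSED subgroup (`I_x` compact,
`[N, Δ]⁻` closed normal), whence `N = ⟨⟨I_x⟩⟩⁻ ≤ I_x · [N, Δ]⁻`.  Consequently the typed [AbsCusp]
Prop. 1.6 (iii) yields the typed Prop. 1.4 (ii) exact sequence under exactly F-0341's kernel hypothesis
(`Prop_1_6_iii.isCuspidallyCentralExtension_of_cuspidalKernel_eq`), and at the model level F-0045 gives
F-0341's clause at every cofinite open of an MLF curve with rational cusps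
(`Prop_1_6_iii_model.isCuspidallyCentralExtension_of_cuspidalKernel_eq`). -/

open scoped commutatorElement in
/-- At a RATIONAL cusp `x` (`D_x ↠ G`, so `Π = D_x · Δ`), if `I_x ≤ N` for normal `N`, then every
`Π`-conjugate of an element of `I_x` lies in `I_x ⊔ [N, Δ]`: writing `g = d δ` with `d ∈ D_x`, `δ ∈ Δ`,
`g i g⁻¹ = d (i · [i⁻¹, δ]) d⁻¹` with `[i⁻¹, δ] ∈ [N, Δ]`, and conjugation by `d` preserves `I_x = D_x ∩ Δ`
and the normal subgroup `[N, Δ]`. [cite: MochizukiAbsCusp2007, Prop 1.6 (iii) p.15] -/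
theorem conj_icusp_mem_sup_commutator_of_isRational (C : E.CuspidalData) (x : C.Cusp)
    (hx : C.IsRational x) (N : Subgroup E.arith) [N.Normal] (hIN : C.Icusp x ≤ N) (g i : E.arith)
    (hi : i ∈ C.Icusp x) : g * i * g⁻¹ ∈ C.Icusp x ⊔ ⁅N, E.geom⁆ := by
  haveI : (⁅N, E.geom⁆).Normal := Subgroup.commutator_normal N E.geom
  -- `g = d * δ`, `d ∈ D_x`, `δ ∈ Δ`
  obtain ⟨d, hd, hdg⟩ := hx (Set.mem_univ (E.aug g))
  set δ : E.arith := d⁻¹ * g with hδ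
  have hδΔ : δ ∈ E.geom := by
    rw [FundamentalExtension.mem_geom, hδ, map_mul, map_inv, hdg, inv_mul_cancel]
  have hg : g = d * δ := by rw [hδ, mul_inv_cancel_left]
  -- `δ i δ⁻¹ = i · [i⁻¹, δ] ∈ I_x ⊔ [N, Δ]`
  have h1 : δ * i * δ⁻¹ ∈ C.Icusp x ⊔ ⁅N, E.geom⁆ := by
    have heq : δ * i * δ⁻¹ = i * (⁅i⁻¹, δ⁆ : E.arith) := by
      rw [commutatorElement_def]
      group
    rw [heq]
    exact Subgroup.mul_mem_sup hi (Subgroup.commutator_mem_commutator (N.inv_mem (hIN hi)) hδΔ)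
  -- conjugation by `d ∈ D_x` preserves `I_x ⊔ [N, Δ]`
  have h2 : MulAut.conj d • (C.Icusp x ⊔ ⁅N, E.geom⁆) = C.Icusp x ⊔ ⁅N, E.geom⁆ := by
    rw [Subgroup.smul_sup, C.Icusp_eq x, Subgroup.smul_inf, Subgroup.conj_smul_eq_self_of_mem hd,
      Subgroup.Normal.conj_smul_eq_self, Subgroup.Normal.conj_smul_eq_self]
  have h3 : MulAut.conj d (δ * i * δ⁻¹) ∈ MulAut.conj d • (C.Icusp x ⊔ ⁅N, E.geom⁆) :=
    Subgroup.smul_mem_pointwise_smul _ _ _ h1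
  rw [h2, MulAut.conj_apply] at h3
  have heq' : g * i * g⁻¹ = d * (δ * i * δ⁻¹) * d⁻¹ := by
    rw [hg]
    group
  rw [heq']
  exact h3

/-- Hence, at a rational cusp `x` with `I_x ≤ N` (`N` normal), the normal closure `⟨⟨I_x⟩⟩` lies in
`I_x ⊔ [N, Δ]`. [cite: MochizukiAbsCusp2007, Prop 1.6 (iii) p.15] -/
theorem normalClosure_icusp_le_of_isRational (C : E.CuspidalData) (x : C.Cusp) (hx : C.IsRational x)
    (N : Subgroup E.arith) [N.Normal] (hIN : C.Icusp x ≤ N) :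
    Subgroup.normalClosure (C.Icusp x : Set E.arith) ≤ C.Icusp x ⊔ ⁅N, E.geom⁆ := by
  change Subgroup.closure (Group.conjugatesOfSet (C.Icusp x : Set E.arith)) ≤ _
  rw [Subgroup.closure_le]
  intro y hy
  obtain ⟨i, hi, hc⟩ := Group.mem_conjugatesOfSet_iff.1 hy
  obtain ⟨g, rfl⟩ := isConj_iff.1 hc
  exact conj_icusp_mem_sup_commutator_of_isRational C x hx N hIN g i hi

/-- **[AbsCusp] Prop. 1.6 (iii) (typed) ⇒ [AbsTopIII] Prop. 1.4 (ii) (typed) under F-0341's kernel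
hypothesis**: if `N = Ker(Δ_{U} ↠ Δ_X)` is the closed normal closure of `I_x` and `x` is rational, then
`1 → I_x → Δ^{c-cn}_{U} → Δ_X → 1` is exact.  (Absorption `N ≤ I_x · [N, Δ]⁻`: the right side is closed —
`I_x` compact, `[N, Δ]⁻` closed normal — and contains `⟨⟨I_x⟩⟩` by
`normalClosure_icusp_le_of_isRational`.) [cite: MochizukiAbsCusp2007, Prop 1.6 (iii) p.15] -/
theorem Prop_1_6_iii.isCuspidallyCentralExtension_of_cuspidalKernel_eq (C : E.CuspidalData) {q : E ⟶ F}
    (h : Prop_1_6_iii q (fun c : C.Cusp => C.Icusp c)) (x : C.Cusp) (hx : C.IsRational x)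
    (hN : AbsTopIII.cuspidalKernel q =
      (Subgroup.normalClosure (C.Icusp x : Set E.arith)).topologicalClosure) :
    AbsTopIII.IsCuspidallyCentralExtension q (C.Icusp x) := by
  have hle : ∀ c : C.Cusp, C.Icusp c ≤ AbsTopIII.cuspidalKernel q := h.2.1
  haveI hNn : (AbsTopIII.cuspidalKernel q).Normal := by
    unfold AbsTopIII.cuspidalKernel
    infer_instance
  haveI hCn : (AbsTopIII.cuspidallyCentralModulus q).Normal := by
    unfold AbsTopIII.cuspidallyCentralModulus
    haveI : (⁅AbsTopIII.cuspidalKernel q, E.geom⁆).Normal := Subgroup.commutator_normal _ _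
    exact Subgroup.is_normal_topologicalClosure _
  refine Prop_1_6_iii.isCuspidallyCentralExtension h x fun y => (hle y).trans ?_
  -- `N ≤ I_x ⊔ C`: `⟨⟨I_x⟩⟩ ≤ I_x ⊔ [N, Δ] ≤ I_x ⊔ C`, the latter closed
  have h1 : Subgroup.normalClosure (C.Icusp x : Set E.arith) ≤
      C.Icusp x ⊔ AbsTopIII.cuspidallyCentralModulus q :=
    (normalClosure_icusp_le_of_isRational C x hx _ (hle x)).trans
      (sup_le_sup_left (Subgroup.le_topologicalClosure _) _)
  have hclosed : IsClosed
      ((C.Icusp x ⊔ AbsTopIII.cuspidallyCentralModulus q : Subgroup E.arith) : Set E.arith) := by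
    rw [Subgroup.mul_normal]
    exact (Subgroup.isClosed_topologicalClosure _).mul_left_of_isCompact (C.isClosed_Icusp x).isCompact
  rw [hN]
  exact Subgroup.topologicalClosure_minimal _ h1 hclosed

/-- **F-0045 ⇒ F-0341's clause at MLF curves with rational cusps**: for every interface `M : CurveModel`,
the model-relative [AbsCusp] Prop. 1.6 (iii) gives, for `U ⊆ X` cofinite open with `X` proper over an
MLF and all cusps of `U` rational, the exact sequence `1 → I_x → Δ^{c-cn}_{U} → Δ_X → 1` at every cusp `x`
satisfying the kernel hypothesis `N = ⟨⟨I_x⟩⟩⁻` of `CurveModel.Prop_1_4_ii` — i.e. that row's conclusion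
(its `IsScheme` hypotheses are not needed; its base field is here an MLF, as in [AbsCusp]).
[cite: MochizukiAbsCusp2007, Prop 1.6 (iii) p.15] -/
theorem Prop_1_6_iii_model.isCuspidallyCentralExtension_of_cuspidalKernel_eq {M : CurveModel.{u}}
    (h : Prop_1_6_iii_model M) {Ux X : M.Curve} (hUX : M.IsCofiniteOpen Ux X) (hX : M.IsProper X)
    (hk : IsMLF (M.base X)) (hrat : ∀ c : (M.cusps Ux).Cusp, (M.cusps Ux).IsRational c)
    (x : (M.cusps Ux).Cusp)
    (hN : AbsTopIII.cuspidalKernel (M.res hUX) =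
      (Subgroup.normalClosure ((M.cusps Ux).Icusp x : Set (M.ext Ux).arith)).topologicalClosure) :
    AbsTopIII.IsCuspidallyCentralExtension (M.res hUX) ((M.cusps Ux).Icusp x) :=
  Prop_1_6_iii.isCuspidallyCentralExtension_of_cuspidalKernel_eq (M.cusps Ux) (h Ux X hUX hX hk hrat) x
    (hrat x) hN

end AbsCusp

end Literature.AnabelianGeometry.AbsoluteAnabelian

end
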